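import Summits.NavierStokesRegularity.FluidComputer.GateBudget
import HarnessLib

/-!
# What no tuning can beat, part 8: THE ENVELOPE LAW — the drain's bite while the rotor over-turns
# (a two-sided averaging lemma for the fast `(a,d)` rotation with the drain acting on `d` only)

Cell `pub-fluidc`, blueprint seat bp1 (gen 25); ONE text with part 9 (`GateBudgetEnvelopeGate.lean`)
split by the 400-line rule; namespace `Summit.NavierStokesRegularity.FluidComputer.GateBudget`
(parts 1–7: `GateBudget*.lean`). HONEST FRAMING (verbatim): low prior, high value-of-information
experiment on Tao's machine paradigm; NOT a claim that NS blows up. Everything concerns five-mode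
quadratic ODEs on `ℝ⁵` — Tao's truncation (5.5) of [Tao2016AveragedNS, §5.5] and the five-coupling
family `fiveGateCircuit ε σ μ R K` of part 1 (with the two-scale slice `rotorCircuit K M ε ρ` of
gen 20) — started EXACTLY at (5.6) `delayInit`; nothing is proved about the Navier–Stokes
equations.

## The question (SPEC-INPUT-bp1 §R′ successor item S13″a; paper/sec-tao-machine.md §2.4zt)

Parts 4–7 bound the drain's effect on the carrier from ONE side at a time (`∂ₜ(a²+d²) ≤ 0` from
the drain, the drain-speed law, the carrier freeze). The firing mechanism of Theorem 5.3, however,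
lives in the regime where the rotor OVER-TURNS: on the window after the trigger `c` has grown, the
pair `(a,d)` rotates at angular speed `ω = R·c` much larger than the drain rate `γ = K·ã`, and the
drain removes energy from the `d`-leg only. Heuristically the rotation equidistributes the energy
between the two legs, so the carrier `E = a² + d²` should decay at the AVERAGED rate `γ = Kã` —
half of the instantaneous worst case `2γ`, and not `0`. Parts 8–9 prove that statement as a
two-sided theorem with explicit error terms, for every exact trajectory and all couplings:

  THE ENVELOPE LAW (part 9, `carrier_envelope_upper` / `carrier_envelope_lower`). On a window
  `[T₁,T₂] ⊆ [0,∞)` on which `c ≥ c₀ > 0`, `R·c ≥ λ ≥ K` and `|b| ≤ b₁`, for every primitive `Γ`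
  of `K·ã`,   `A⁻¹·e^{-(Γ(t)-Γ(T₁)) - δ(t-T₁)}·E(T₁) ≤ E(t) ≤ A·e^{-(Γ(t)-Γ(T₁)) + δ(t-T₁)}·E(T₁)`
  with `A = (1+κ₁/2)/(1-κ₁/2)`, `κ₁ = K/λ`, `δ = (2p₁ + k/2)/(1 - κ₁/2)`, `p₁ = εb₁ + σ` (clock and
  seed acting on `a`) and `k = (K/λ)(p₁ + K + σ/c₀ + μb₁)` (the adiabatic error of the tilt). With
  a floor `ã ≥ θ₀` this reads `E(t) ≤ 3·e^{-(Kθ₀ - 4p₁ - k)(t-T₁)}·E(T₁)`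
  (`carrier_envelope_floor`),
  with a ceiling `ã ≤ θ₁` it reads `E(t) ≥ ⅓·e^{-(Kθ₁ + 4p₁ + k)(t-T₁)}·E(T₁)`
  (`carrier_envelope_ceiling`): the drain bites at rate `K·ã·(1 + O(K/λ))`, no more and no less,
  as long as the rotor over-turns (`λ ≫ K + μb₁`).

THE DEVICE (this part, stated for an abstract planar pair `a' = -ωd - pa`, `d' = ωa - γd` so that
the other seats can re-use it): the TILTED ENERGY `V = a² + d² - κ·ad` with the time-dependent
tilt `κ = γ/ω`. One line of algebra (`tilt_identity`) gives `V' + γV = (κp - κ')·ad - 2p·a²` —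
the rotation has been averaged out EXACTLY, at the price of the adiabatic term `κ' = (γ/ω)'` —
and `(1-κ/2)E ≤ V ≤ (1+κ/2)E` (`tilt_pointwise`); two integrating factors
(`Thm53.antitoneOn_intFactor`, `monotoneOn_intFactor`) then give both sides at once
(`pair_envelope_upper`, `pair_envelope_lower`). No averaging over periods, no hitting times, no
bootstrap. For comparison the CRUDE bounds `e^{-2(p₁+γ₁)Δt} ≤ E(t)/E(T₁) ≤ e^{2p₁Δt}`
(`pairEnergy_crude_lower/upper`; part 9 `carrier_crude_lower/upper`) need no rotor at all and
stay valid through the rotor stop `R·c ≲ K`, where the envelope law does not apply (its error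
`k` is not small there) — that end-game is the successor item. §19b collects the pure real
arithmetic of the circuit's tilt `κ = Kã/(Rc)` (`carrier_consts`) used by part 9.

## Dictionary to Tao's (5.5) and to the knob family

(5.5) is `fiveGateCircuit ε (ε²e^{-K¹⁰}) (ε⁻¹K¹⁰) ε⁻² K` (`delayCircuit_eq_fiveGate`, part 1) and
gen 20's two-scale family is `rotorCircuit K M ε ρ = fiveGateCircuit ε (ρ²e^{-M}) (ε⁻¹M) ρ⁻² K`
(`RotorKnob.rotorCircuit_eq_fiveGate`). Part 9 §21 rewrites the law in knob coordinates
(`rotorKnob_carrier_envelope`, `rotorKnob_carrier_ceiling`): with `c/ρ² ≥ λ ≥ max(K,1)` on the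
window, `ρ² ≤ ε ≤ 1`, the clock budget `|b| ≤ 2εT₂` of part 1 and `σ/c₀ = e^{-M}/λ`, the rate
error is `η = 8ε²T₂ + 4εe^{-M} + (K/λ)(K + 2(M+1)T₂ + 2)`: the carrier decays like `exp(-K∫ã)`
up to `e^{±ηΔt}` and a factor `3^{±1}` whenever the trigger over-turns the drain and the
amplifier sweep, `c/ρ² ≫ K + MT₂`.

## What this is NOT

Not a statement near the rotor stop (`R·c ~ K`), not a necessity theorem for firing (that needs
this law AND the end-game), and not a claim about Navier–Stokes. [cite: Tao2016AveragedNS, §5.5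
(5.5), (5.6), Theorem 5.3 and its proof: (energy-con), (est), (a-eq)–(ta-eq)]. Theorems only; no
named facts; 0 sorry.
-/

noncomputable section

namespace Summit.NavierStokesRegularity.FluidComputer.GateBudget

open Real Set Filter Topology
open Literature.Analysis.FluidPDE.Tao2016AveragedNS
open Literature.Analysis.FluidPDE.Tao2016AveragedNS.Thm53 (antitoneOn_intFactor monotoneOn_intFactor
  antitoneOn_sub_of_deriv_le monotoneOn_sub_of_le_deriv init_a init_b init_c init_d init_e)

/-! ## §19 A planar rotation with a drain on one leg: energy, crude bounds, tilt, envelope -/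

/-- Bookkeeping: `u·eˣ ≤ v·eʸ ⇒ u ≤ v·e^{y-x}`. [folklore] -/
theorem le_mul_exp_of_mul_exp_le {u v x y : ℝ} (h : u * exp x ≤ v * exp y) :
    u ≤ v * exp (y - x) := by
  rw [exp_sub, mul_div_assoc', le_div_iff₀ (exp_pos x)]
  exact h

/-- Bookkeeping: `u·eˣ ≤ v·eʸ ⇒ u·e^{x-y} ≤ v`. [folklore] -/
theorem mul_exp_le_of_mul_exp_le {u v x y : ℝ} (h : u * exp x ≤ v * exp y) :
    u * exp (x - y) ≤ v := by
  rw [exp_sub, mul_div_assoc', div_le_iff₀ (exp_pos y)]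
  exact h

/-- Energy identity of a rotating pair `a' = -ωd - pa`, `d' = ωa - γd`:
`(a² + d²)' = -2pa² - 2γd²` — the rotation cancels, the drain bites on the `d`-leg only.
[cite: Tao2016AveragedNS, §5.5 (a-eq), (d-eq)] -/
theorem pairEnergy_hasDerivAt {a d : ℝ → ℝ} {t w q g : ℝ}
    (ha : HasDerivAt a (-(w * d t) - q * a t) t) (hd : HasDerivAt d (w * a t - g * d t) t) :
    HasDerivAt (fun s => a s ^ 2 + d s ^ 2) (-(2 * q * a t ^ 2) - 2 * g * d t ^ 2) t := by
  refine ((ha.fun_pow 2).fun_add (hd.fun_pow 2)).congr_deriv ?_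
  simp only [show (2 : ℕ) - 1 = 1 from rfl, pow_one, Nat.cast_ofNat]
  ring

/-- **CRUDE LOWER BOUND (the drain ceiling; valid through the rotor stop).** If `|p| ≤ p₁` and
`0 ≤ γ ≤ γ₁` on `[T₁,T₂]` then `e^{-2(p₁+γ₁)(t-T₁)}·E(T₁) ≤ E(t)`, `E = a² + d²`, whatever `ω` does:
the drain never removes the carrier faster than rate `2γ₁`. [folklore] -/
theorem pairEnergy_crude_lower {a d ω p γ : ℝ → ℝ} {T₁ T₂ p₁ γ₁ : ℝ}
    (ha : ∀ t ∈ Icc T₁ T₂, HasDerivAt a (-(ω t * d t) - p t * a t) t)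
    (hd : ∀ t ∈ Icc T₁ T₂, HasDerivAt d (ω t * a t - γ t * d t) t)
    (hp : ∀ t ∈ Icc T₁ T₂, |p t| ≤ p₁) (hγ0 : ∀ t ∈ Icc T₁ T₂, 0 ≤ γ t)
    (hγ : ∀ t ∈ Icc T₁ T₂, γ t ≤ γ₁) {t : ℝ} (ht : t ∈ Icc T₁ T₂) :
    exp (-(2 * (p₁ + γ₁) * (t - T₁))) * (a T₁ ^ 2 + d T₁ ^ 2) ≤ a t ^ 2 + d t ^ 2 := by
  have hmono := monotoneOn_intFactor (f := fun r => a r ^ 2 + d r ^ 2)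
    (f' := fun r => -(2 * p r * a r ^ 2) - 2 * γ r * d r ^ 2) (g := fun _ => -(2 * (p₁ + γ₁)))
    (G := fun r => -(2 * (p₁ + γ₁)) * r) (φ := fun _ => 0) (Φ := fun _ => 0) (convex_Icc T₁ T₂)
    (fun r hr => pairEnergy_hasDerivAt (ha r hr) (hd r hr))
    (fun r _ => ((hasDerivAt_id' r).const_mul _).congr_deriv (by simp))
    (fun r _ => hasDerivAt_const r (0 : ℝ))
    (fun r hr => by
      have hpr := abs_le.1 (hp r hr)
      have h1 : 0 ≤ -(2 * p r * a r ^ 2) - 2 * γ r * d r ^ 2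
          - -(2 * (p₁ + γ₁)) * (a r ^ 2 + d r ^ 2) := by
        nlinarith [mul_nonneg (sq_nonneg (a r)) (by linarith : 0 ≤ p₁ + p r),
          mul_nonneg (sq_nonneg (d r)) (by linarith [hγ r hr] : 0 ≤ γ₁ - γ r),
          mul_nonneg (sq_nonneg (a r)) (hγ0 r hr),
          mul_nonneg (sq_nonneg (a r)) ((hγ0 r hr).trans (hγ r hr)),
          mul_nonneg (sq_nonneg (d r)) ((abs_nonneg _).trans (hp r hr))]
      exact mul_nonneg h1 (exp_pos _).le)
  have h := hmono (left_mem_Icc.2 (ht.1.trans ht.2)) ht ht.1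
  simp only [sub_zero] at h
  have h' := mul_exp_le_of_mul_exp_le h
  rw [show -(-(2 * (p₁ + γ₁)) * T₁) - -(-(2 * (p₁ + γ₁)) * t) = -(2 * (p₁ + γ₁) * (t - T₁)) by ring,
    mul_comm] at h'
  exact h'

/-- **CRUDE UPPER BOUND.** If `|p| ≤ p₁` and `0 ≤ γ` on `[T₁,T₂]` then `E(t) ≤ e^{2p₁(t-T₁)}·E(T₁)`:
only the pumps acting on `a` can feed the pair. [folklore] -/
theorem pairEnergy_crude_upper {a d ω p γ : ℝ → ℝ} {T₁ T₂ p₁ : ℝ}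
    (ha : ∀ t ∈ Icc T₁ T₂, HasDerivAt a (-(ω t * d t) - p t * a t) t)
    (hd : ∀ t ∈ Icc T₁ T₂, HasDerivAt d (ω t * a t - γ t * d t) t)
    (hp : ∀ t ∈ Icc T₁ T₂, |p t| ≤ p₁) (hγ0 : ∀ t ∈ Icc T₁ T₂, 0 ≤ γ t) {t : ℝ}
    (ht : t ∈ Icc T₁ T₂) :
    a t ^ 2 + d t ^ 2 ≤ exp (2 * p₁ * (t - T₁)) * (a T₁ ^ 2 + d T₁ ^ 2) := by
  have hanti := antitoneOn_intFactor (f := fun r => a r ^ 2 + d r ^ 2)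
    (f' := fun r => -(2 * p r * a r ^ 2) - 2 * γ r * d r ^ 2) (g := fun _ => 2 * p₁)
    (G := fun r => 2 * p₁ * r) (φ := fun _ => 0) (Φ := fun _ => 0) (convex_Icc T₁ T₂)
    (fun r hr => pairEnergy_hasDerivAt (ha r hr) (hd r hr))
    (fun r _ => ((hasDerivAt_id' r).const_mul _).congr_deriv (by simp))
    (fun r _ => hasDerivAt_const r (0 : ℝ))
    (fun r hr => by
      have hpr := abs_le.1 (hp r hr)
      have h1 : -(2 * p r * a r ^ 2) - 2 * γ r * d r ^ 2 - 2 * p₁ * (a r ^ 2 + d r ^ 2) ≤ 0 := by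
        nlinarith [mul_nonneg (sq_nonneg (a r)) (by linarith : 0 ≤ p₁ + p r),
          mul_nonneg (sq_nonneg (d r)) (hγ0 r hr),
          mul_nonneg (sq_nonneg (d r)) ((abs_nonneg _).trans (hp r hr))]
      nlinarith [exp_pos (-(2 * p₁ * r))])
  have h := hanti (left_mem_Icc.2 (ht.1.trans ht.2)) ht ht.1
  simp only [sub_zero] at h
  have h' := le_mul_exp_of_mul_exp_le h
  rw [show -(2 * p₁ * T₁) - -(2 * p₁ * t) = 2 * p₁ * (t - T₁) by ring, mul_comm] at h'
  exact h'

/-- The TILTED ENERGY `V = a² + d² - κ·ad` and its derivative along the pair. [folklore] -/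
theorem tilt_hasDerivAt {a d κ : ℝ → ℝ} {t w q g k' : ℝ}
    (ha : HasDerivAt a (-(w * d t) - q * a t) t) (hd : HasDerivAt d (w * a t - g * d t) t)
    (hκ : HasDerivAt κ k' t) :
    HasDerivAt (fun s => a s ^ 2 + d s ^ 2 - κ s * (a s * d s))
      (-(2 * q * a t ^ 2) - 2 * g * d t ^ 2
        - (k' * (a t * d t)
          + κ t * ((-(w * d t) - q * a t) * d t + a t * (w * a t - g * d t)))) t :=
  (pairEnergy_hasDerivAt ha hd).fun_sub (hκ.fun_mul (ha.fun_mul hd))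

/-- **THE TILT IDENTITY.** With the tilt `κ = γ/ω` (here `γ = κ·w`) the rotation is averaged out
exactly: `V' + γV = (κq - κ')·ad - 2q·a²`. [folklore] -/
theorem tilt_identity (a d κ w q k' : ℝ) :
    -(2 * q * a ^ 2) - 2 * (κ * w) * d ^ 2
        - (k' * (a * d) + κ * ((-(w * d) - q * a) * d + a * (w * a - κ * w * d)))
      + κ * w * (a ^ 2 + d ^ 2 - κ * (a * d)) = (κ * q - k') * (a * d) - 2 * q * a ^ 2 := by
  ring

/-- Pointwise bounds for the tilt: `|(κq - κ')ad - 2qa²| ≤ (2q₁ + k/2)(a² + d²)` when `|q| ≤ q₁`,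
`|κq - κ'| ≤ k`; and `(1 - κ₁/2)E ≤ V ≤ (1 + κ₁/2)E` when `0 ≤ κ ≤ κ₁`. [folklore] -/
theorem tilt_pointwise {a d κ q k' κ₁ q₁ k : ℝ} (hκ0 : 0 ≤ κ) (hκ1 : κ ≤ κ₁) (hq : |q| ≤ q₁)
    (hk : |κ * q - k'| ≤ k) :
    |(κ * q - k') * (a * d) - 2 * q * a ^ 2| ≤ (2 * q₁ + k / 2) * (a ^ 2 + d ^ 2) ∧
    (1 - κ₁ / 2) * (a ^ 2 + d ^ 2) ≤ a ^ 2 + d ^ 2 - κ * (a * d) ∧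
    a ^ 2 + d ^ 2 - κ * (a * d) ≤ (1 + κ₁ / 2) * (a ^ 2 + d ^ 2) := by
  have had : |a * d| ≤ (a ^ 2 + d ^ 2) / 2 :=
    abs_le.2 ⟨by nlinarith [sq_nonneg (a + d)], by nlinarith [sq_nonneg (a - d)]⟩
  have hq' := abs_le.1 hq
  have hq₁ : 0 ≤ q₁ := (abs_nonneg q).trans hq
  have h1 : |(κ * q - k') * (a * d)| ≤ k * ((a ^ 2 + d ^ 2) / 2) := by
    rw [abs_mul]; exact mul_le_mul hk had (abs_nonneg _) ((abs_nonneg _).trans hk)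
  have h1' := abs_le.1 h1
  have e3 : κ * |a * d| ≤ κ₁ * ((a ^ 2 + d ^ 2) / 2) :=
    mul_le_mul hκ1 had (abs_nonneg _) (hκ0.trans hκ1)
  have e2 : κ * (a * d) ≤ κ * |a * d| := mul_le_mul_of_nonneg_left (le_abs_self _) hκ0
  have e2' : -(κ * (a * d)) ≤ κ * |a * d| := by
    rw [← mul_neg]; exact mul_le_mul_of_nonneg_left (neg_le_abs _) hκ0
  refine ⟨abs_le.2 ⟨?_, ?_⟩, by linarith, by linarith⟩
  · nlinarith [mul_nonneg (sq_nonneg a) (by linarith : 0 ≤ q₁ - q), sq_nonneg d]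
  · nlinarith [mul_nonneg (sq_nonneg a) (by linarith : 0 ≤ q₁ + q), sq_nonneg d]

/-- **THE ENVELOPE LAW, upper side (abstract).** For a pair `a' = -ωd - pa`, `d' = ωa - γd` on
`[T₁,T₂]` with a differentiable tilt `κ`, `κω = γ`, `0 ≤ κ ≤ κ₁ < 2`, `|p| ≤ p₁`, `|κp - κ'| ≤ k`
and any primitive `Γ' = γ`: `E(t) ≤ (1+κ₁/2)/(1-κ₁/2)·exp(-(Γ(t)-Γ(T₁)) + δ(t-T₁))·E(T₁)`,
`δ = (2p₁ + k/2)/(1 - κ₁/2)` — the pair decays at the AVERAGED drain rate `γ` up to the errors.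
[folklore] -/
theorem pair_envelope_upper {a d ω p γ κ κ' Γ : ℝ → ℝ} {T₁ T₂ κ₁ p₁ k : ℝ} (hκ₁ : κ₁ < 2)
    (ha : ∀ t ∈ Icc T₁ T₂, HasDerivAt a (-(ω t * d t) - p t * a t) t)
    (hd : ∀ t ∈ Icc T₁ T₂, HasDerivAt d (ω t * a t - γ t * d t) t)
    (hκ : ∀ t ∈ Icc T₁ T₂, HasDerivAt κ (κ' t) t) (hΓ : ∀ t ∈ Icc T₁ T₂, HasDerivAt Γ (γ t) t)
    (hκω : ∀ t ∈ Icc T₁ T₂, κ t * ω t = γ t) (hκ0 : ∀ t ∈ Icc T₁ T₂, 0 ≤ κ t)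
    (hκ1 : ∀ t ∈ Icc T₁ T₂, κ t ≤ κ₁) (hp : ∀ t ∈ Icc T₁ T₂, |p t| ≤ p₁)
    (hk : ∀ t ∈ Icc T₁ T₂, |κ t * p t - κ' t| ≤ k) {t : ℝ} (ht : t ∈ Icc T₁ T₂) :
    a t ^ 2 + d t ^ 2 ≤ (1 + κ₁ / 2) / (1 - κ₁ / 2)
      * exp (-(Γ t - Γ T₁) + (2 * p₁ + k / 2) / (1 - κ₁ / 2) * (t - T₁))
      * (a T₁ ^ 2 + d T₁ ^ 2) := by
  have hT₁ : T₁ ∈ Icc T₁ T₂ := left_mem_Icc.2 (ht.1.trans ht.2)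
  have hm : 0 < 1 - κ₁ / 2 := by linarith
  have hp₁ : 0 ≤ p₁ := (abs_nonneg _).trans (hp t ht)
  have hk0 : 0 ≤ k := (abs_nonneg _).trans (hk t ht)
  set δ := (2 * p₁ + k / 2) / (1 - κ₁ / 2) with hδ
  have hδ0 : 0 ≤ δ := by positivity
  have hδm : δ * (1 - κ₁ / 2) = 2 * p₁ + k / 2 := div_mul_cancel₀ _ hm.ne'
  have hpt : ∀ r ∈ Icc T₁ T₂, -(2 * p r * a r ^ 2) - 2 * γ r * d r ^ 2
      - (κ' r * (a r * d r)
        + κ r * ((-(ω r * d r) - p r * a r) * d r + a r * (ω r * a r - γ r * d r)))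
      - (δ - γ r) * (a r ^ 2 + d r ^ 2 - κ r * (a r * d r)) ≤ 0 := by
    intro r hr
    obtain ⟨h1, h2, -⟩ :=
      tilt_pointwise (a := a r) (d := d r) (hκ0 r hr) (hκ1 r hr) (hp r hr) (hk r hr)
    have key := tilt_identity (a r) (d r) (κ r) (ω r) (p r) (κ' r)
    rw [hκω r hr] at key
    have h1' := (abs_le.1 h1).2
    have hE : (2 * p₁ + k / 2) * (a r ^ 2 + d r ^ 2)
        ≤ δ * (a r ^ 2 + d r ^ 2 - κ r * (a r * d r)) := by
      have := mul_le_mul_of_nonneg_left h2 hδ0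
      rw [← mul_assoc, hδm] at this
      exact this
    linarith
  have hanti := antitoneOn_intFactor (f := fun r => a r ^ 2 + d r ^ 2 - κ r * (a r * d r))
    (f' := fun r => -(2 * p r * a r ^ 2) - 2 * γ r * d r ^ 2
      - (κ' r * (a r * d r)
        + κ r * ((-(ω r * d r) - p r * a r) * d r + a r * (ω r * a r - γ r * d r))))
    (g := fun r => δ - γ r) (G := fun r => δ * r - Γ r) (φ := fun _ => 0) (Φ := fun _ => 0)
    (convex_Icc T₁ T₂) (fun r hr => tilt_hasDerivAt (ha r hr) (hd r hr) (hκ r hr))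
    (fun r hr => (((hasDerivAt_id' r).const_mul δ).sub (hΓ r hr)).congr_deriv (by simp))
    (fun r _ => hasDerivAt_const r (0 : ℝ))
    (fun r hr => by nlinarith [hpt r hr, exp_pos (-(δ * r - Γ r))])
  have h := hanti hT₁ ht ht.1
  simp only [sub_zero] at h
  have h' := le_mul_exp_of_mul_exp_le h
  rw [show -(δ * T₁ - Γ T₁) - -(δ * t - Γ t) = -(Γ t - Γ T₁) + δ * (t - T₁) by ring] at h'
  obtain ⟨-, h2t, -⟩ :=
    tilt_pointwise (a := a t) (d := d t) (hκ0 t ht) (hκ1 t ht) (hp t ht) (hk t ht)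
  obtain ⟨-, -, h3⟩ := tilt_pointwise (a := a T₁) (d := d T₁) (hκ0 T₁ hT₁) (hκ1 T₁ hT₁) (hp T₁ hT₁)
    (hk T₁ hT₁)
  have hexp := exp_pos (-(Γ t - Γ T₁) + δ * (t - T₁))
  have c3 := mul_le_mul_of_nonneg_right h3 hexp.le
  rw [div_mul_eq_mul_div, div_mul_eq_mul_div, le_div_iff₀ hm]
  nlinarith

/-- **THE ENVELOPE LAW, lower side (abstract).** Same hypotheses:
`(1-κ₁/2)/(1+κ₁/2)·exp(-(Γ(t)-Γ(T₁)) - δ(t-T₁))·E(T₁) ≤ E(t)` — the drain cannot do better than the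
averaged rate `γ` either. [folklore] -/
theorem pair_envelope_lower {a d ω p γ κ κ' Γ : ℝ → ℝ} {T₁ T₂ κ₁ p₁ k : ℝ} (hκ₁ : κ₁ < 2)
    (ha : ∀ t ∈ Icc T₁ T₂, HasDerivAt a (-(ω t * d t) - p t * a t) t)
    (hd : ∀ t ∈ Icc T₁ T₂, HasDerivAt d (ω t * a t - γ t * d t) t)
    (hκ : ∀ t ∈ Icc T₁ T₂, HasDerivAt κ (κ' t) t) (hΓ : ∀ t ∈ Icc T₁ T₂, HasDerivAt Γ (γ t) t)
    (hκω : ∀ t ∈ Icc T₁ T₂, κ t * ω t = γ t) (hκ0 : ∀ t ∈ Icc T₁ T₂, 0 ≤ κ t)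
    (hκ1 : ∀ t ∈ Icc T₁ T₂, κ t ≤ κ₁) (hp : ∀ t ∈ Icc T₁ T₂, |p t| ≤ p₁)
    (hk : ∀ t ∈ Icc T₁ T₂, |κ t * p t - κ' t| ≤ k) {t : ℝ} (ht : t ∈ Icc T₁ T₂) :
    (1 - κ₁ / 2) / (1 + κ₁ / 2)
      * exp (-(Γ t - Γ T₁) - (2 * p₁ + k / 2) / (1 - κ₁ / 2) * (t - T₁)) * (a T₁ ^ 2 + d T₁ ^ 2)
      ≤ a t ^ 2 + d t ^ 2 := by
  have hT₁ : T₁ ∈ Icc T₁ T₂ := left_mem_Icc.2 (ht.1.trans ht.2)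
  have hm : 0 < 1 - κ₁ / 2 := by linarith
  have hκ₁0 : 0 ≤ κ₁ := (hκ0 t ht).trans (hκ1 t ht)
  have hM : 0 < 1 + κ₁ / 2 := by linarith
  have hp₁ : 0 ≤ p₁ := (abs_nonneg _).trans (hp t ht)
  have hk0 : 0 ≤ k := (abs_nonneg _).trans (hk t ht)
  set δ := (2 * p₁ + k / 2) / (1 - κ₁ / 2) with hδ
  have hδ0 : 0 ≤ δ := by positivity
  have hδm : δ * (1 - κ₁ / 2) = 2 * p₁ + k / 2 := div_mul_cancel₀ _ hm.ne'
  have hpt : ∀ r ∈ Icc T₁ T₂, 0 ≤ -(2 * p r * a r ^ 2) - 2 * γ r * d r ^ 2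
      - (κ' r * (a r * d r)
        + κ r * ((-(ω r * d r) - p r * a r) * d r + a r * (ω r * a r - γ r * d r)))
      - -(δ + γ r) * (a r ^ 2 + d r ^ 2 - κ r * (a r * d r)) := by
    intro r hr
    obtain ⟨h1, h2, -⟩ :=
      tilt_pointwise (a := a r) (d := d r) (hκ0 r hr) (hκ1 r hr) (hp r hr) (hk r hr)
    have key := tilt_identity (a r) (d r) (κ r) (ω r) (p r) (κ' r)
    rw [hκω r hr] at key
    have h1' := (abs_le.1 h1).1
    have hE : (2 * p₁ + k / 2) * (a r ^ 2 + d r ^ 2)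
        ≤ δ * (a r ^ 2 + d r ^ 2 - κ r * (a r * d r)) := by
      have := mul_le_mul_of_nonneg_left h2 hδ0
      rw [← mul_assoc, hδm] at this
      exact this
    linarith
  have hmono := monotoneOn_intFactor (f := fun r => a r ^ 2 + d r ^ 2 - κ r * (a r * d r))
    (f' := fun r => -(2 * p r * a r ^ 2) - 2 * γ r * d r ^ 2
      - (κ' r * (a r * d r)
        + κ r * ((-(ω r * d r) - p r * a r) * d r + a r * (ω r * a r - γ r * d r))))
    (g := fun r => -(δ + γ r)) (G := fun r => -(δ * r + Γ r)) (φ := fun _ => 0) (Φ := fun _ => 0)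
    (convex_Icc T₁ T₂) (fun r hr => tilt_hasDerivAt (ha r hr) (hd r hr) (hκ r hr))
    (fun r hr => (((hasDerivAt_id' r).const_mul δ).add (hΓ r hr)).neg.congr_deriv (by simp))
    (fun r _ => hasDerivAt_const r (0 : ℝ))
    (fun r hr => by nlinarith [hpt r hr, exp_pos (-(-(δ * r + Γ r)))])
  have h := hmono hT₁ ht ht.1
  simp only [sub_zero] at h
  have h' := mul_exp_le_of_mul_exp_le h
  rw [show -(-(δ * T₁ + Γ T₁)) - -(-(δ * t + Γ t)) = -(Γ t - Γ T₁) - δ * (t - T₁) by ring] at h'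
  obtain ⟨-, -, h3t⟩ :=
    tilt_pointwise (a := a t) (d := d t) (hκ0 t ht) (hκ1 t ht) (hp t ht) (hk t ht)
  obtain ⟨-, h2, -⟩ := tilt_pointwise (a := a T₁) (d := d T₁) (hκ0 T₁ hT₁) (hκ1 T₁ hT₁) (hp T₁ hT₁)
    (hk T₁ hT₁)
  have hexp := exp_pos (-(Γ t - Γ T₁) - δ * (t - T₁))
  have c3 := mul_le_mul_of_nonneg_right h2 hexp.le
  rw [div_mul_eq_mul_div, div_mul_eq_mul_div, div_le_iff₀ hM]
  nlinarith

/-! ## §19b The constants of the circuit's tilt (pure real arithmetic, used by part 9) -/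

/-- **The constants of the tilt `κ = Kã/(Rc)`** at a point where `a², d² ≤ 1`, `0 ≤ ã ≤ 1`,
`c₀ ≤ c ≤ 1`, `Rc ≥ λ > 0`, `|b| ≤ b₁` (`ε, σ, μ, K ≥ 0`): `0 ≤ κ ≤ K/λ`, `κ·(Rc) = Kã`,
`|εb + σc| ≤ p₁ := εb₁ + σ`, and the adiabatic error `|κp - κ'| ≤ k := (K/λ)(p₁ + K + σ/c₀ + μb₁)`
where `κ' = (K·Kd²·Rc - Kã·R(σa² + μbc))/(Rc)²`. [cite: Tao2016AveragedNS, §5.5 (5.5), (est)] -/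
theorem carrier_consts {ε σ μ R K a b c d e c₀ lam b₁ : ℝ} (hε : 0 ≤ ε) (hσ : 0 ≤ σ) (hμ : 0 ≤ μ)
    (hK : 0 ≤ K) (hc₀ : 0 < c₀) (hlam : 0 < lam) (ha : a ^ 2 ≤ 1) (hb : |b| ≤ b₁) (hcc : c₀ ≤ c)
    (hc1 : c ≤ 1) (hd : d ^ 2 ≤ 1) (he0 : 0 ≤ e) (he1 : e ≤ 1) (hu : lam ≤ R * c) :
    0 ≤ K * e / (R * c) ∧ K * e / (R * c) ≤ K / lam ∧ K * e / (R * c) * (R * c) = K * e ∧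
    |ε * b + σ * c| ≤ ε * b₁ + σ ∧
    |K * e / (R * c) * (ε * b + σ * c)
        - (K * (K * d ^ 2) * (R * c) - K * e * (R * (σ * a ^ 2 + μ * b * c))) / (R * c) ^ 2|
      ≤ K / lam * (ε * b₁ + σ + K + σ / c₀ + μ * b₁) := by
  have hu0 : 0 < R * c := hlam.trans_le hu
  have hc0 : 0 < c := hc₀.trans_le hcc
  have hR : 0 < R := by nlinarith
  have hb0 : 0 ≤ b₁ := (abs_nonneg b).trans hb
  have hκ0 : 0 ≤ K * e / (R * c) := div_nonneg (mul_nonneg hK he0) hu0.le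
  have hκ1 : K * e / (R * c) ≤ K / lam := div_le_div₀ hK (mul_le_of_le_one_right hK he1) hlam hu
  have hp : |ε * b + σ * c| ≤ ε * b₁ + σ := by
    refine (abs_add_le _ _).trans ?_
    rw [abs_mul, abs_mul, abs_of_nonneg hε, abs_of_nonneg hσ, abs_of_pos hc0]
    nlinarith [mul_le_mul_of_nonneg_left hb hε, mul_le_mul_of_nonneg_left hc1 hσ]
  refine ⟨hκ0, hκ1, div_mul_cancel₀ _ hu0.ne', hp, ?_⟩
  -- split `κ'` into its three fractions
  have hsplit : (K * (K * d ^ 2) * (R * c) - K * e * (R * (σ * a ^ 2 + μ * b * c))) / (R * c) ^ 2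
      = K * K * d ^ 2 / (R * c) - K * e * σ * a ^ 2 / (R * c * c) - K * e * μ * b / (R * c) := by
    field_simp
    ring
  rw [hsplit]
  have t1 : |K * e / (R * c) * (ε * b + σ * c)| ≤ K / lam * (ε * b₁ + σ) := by
    rw [abs_mul, abs_of_nonneg hκ0]
    exact mul_le_mul hκ1 hp (abs_nonneg _) (by positivity)
  have t2 : |K * K * d ^ 2 / (R * c)| ≤ K * K / lam := by
    rw [abs_of_nonneg (by positivity)]
    exact div_le_div₀ (by positivity) (by nlinarith [mul_nonneg hK hK]) hlam hu
  have t3 : |K * e * σ * a ^ 2 / (R * c * c)| ≤ K * σ / (lam * c₀) := by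
    rw [abs_of_nonneg (by positivity)]
    refine div_le_div₀ (by positivity) ?_ (by positivity) ?_
    · have : K * e * σ * a ^ 2 ≤ K * σ * (e * a ^ 2) := by nlinarith
      nlinarith [mul_le_one₀ he1 (sq_nonneg a) ha, mul_nonneg hK hσ]
    · exact mul_le_mul hu hcc hc₀.le hu0.le
  have t4 : |K * e * μ * b / (R * c)| ≤ K * μ * b₁ / lam := by
    rw [abs_div, abs_of_pos hu0, abs_mul, abs_of_nonneg (by positivity : 0 ≤ K * e * μ)]
    refine div_le_div₀ (by positivity) ?_ hlam hu
    calc K * e * μ * |b| ≤ K * 1 * μ * b₁ := by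
          apply mul_le_mul _ hb (abs_nonneg _) (by positivity)
          exact mul_le_mul_of_nonneg_right (mul_le_mul_of_nonneg_left he1 hK) hμ
      _ = K * μ * b₁ := by ring
  have hsum : K / lam * (ε * b₁ + σ) + K * K / lam + K * σ / (lam * c₀) + K * μ * b₁ / lam
      = K / lam * (ε * b₁ + σ + K + σ / c₀ + μ * b₁) := by
    field_simp
  calc |K * e / (R * c) * (ε * b + σ * c)
          - (K * K * d ^ 2 / (R * c) - K * e * σ * a ^ 2 / (R * c * c) - K * e * μ * b / (R * c))|
        ≤ |K * e / (R * c) * (ε * b + σ * c)| + |K * K * d ^ 2 / (R * c)|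
          + |K * e * σ * a ^ 2 / (R * c * c)| + |K * e * μ * b / (R * c)| := by
        have e1 := abs_sub (K * e / (R * c) * (ε * b + σ * c))
          (K * K * d ^ 2 / (R * c) - K * e * σ * a ^ 2 / (R * c * c) - K * e * μ * b / (R * c))
        have e2 := abs_sub (K * K * d ^ 2 / (R * c) - K * e * σ * a ^ 2 / (R * c * c))
          (K * e * μ * b / (R * c))
        have e3 := abs_sub (K * K * d ^ 2 / (R * c)) (K * e * σ * a ^ 2 / (R * c * c))
        linarith
    _ ≤ K / lam * (ε * b₁ + σ) + K * K / lam + K * σ / (lam * c₀) + K * μ * b₁ / lam := by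
        linarith
    _ = K / lam * (ε * b₁ + σ + K + σ / c₀ + μ * b₁) := hsum

end Summit.NavierStokesRegularity.FluidComputer.GateBudget
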